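import Summits.QuantumFields.YangMills.Theorems.UnitScaleTiltProp7CovFaceFluxLineStep
import Summits.QuantumFields.YangMills.Theorems.UnitScaleTiltProp7CovFaceFluxFacePiece
import Summits.QuantumFields.YangMills.Theorems.UnitScaleTiltProp7CovariantTransport
import HarnessLib

/-!
# Route `UnitScaleTilt`, crux K1 «MinimiserStabilityRegPr» (stmt-QuantumFields-19200), route-R E′ S3 K-form engine, row R3′ ∕ (P′) — «HE-PRIME»:
# the (E)-row of px17's R3′ door with the COMB-DIRECT face functional `FACE′` in place of the per-line `FACE`:
# `Σ_c ‖LINE_c − FACE′_c‖² ≤ 2·ℓ⁴V_k⁻¹·G_long(Y) + 2·(G2)`, (G2) = ✓p670095's `((2d+1)ℓ)⁴δ²∕4·2ℓ²V_k⁻¹·(M(Y) + ℓ²G_long(Y))` — so the face defect is paid in the `Elong` slot and the Gauss row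
# can be displayed against `FACE′` (whose pairing with the coarse differences is the block net flux EXACTLY: ✓ `Prop7CovBlockGauss` §3–§4, LOCATE-HXB-SPLIT cure (b))

Cell `ym3-torus`, width seat `ym3-torus-px15` (gen 3); hXb-inhabitant lane («BLOCK-GAUSS» GO, ★ym-ust-19200-p1 g16 WORD 10 (2)), my side of LOCATE-HXB-SPLIT-px15g3 §0.2 cure (b).  THEOREMS ONLY (0 `def`,
0 `sorry`, 0 `instance`); `--supports stmt-QuantumFields-19200`, count-neutral.  YM₃ on T³ is a ladder rung (R3), not the Clay problem; nothing here claims a stub, the crux, d = 4 or the mass gap.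

WHAT IS PROVED (ns `…Theorems.Prop7CovFaceFluxLineStepPrime`; `SU(N)` background `W` read as units `unitsField (toUField W)`, `PlaqSmall δ W`, contractive frames `gL gR`, corner combs, face
indices `s′ c r = r_{μ_c} + t₀ c r`).
* `norm_sub_sq_le_two` — `‖a − c‖² ≤ 2‖a − b‖² + 2‖b − c‖²`.
* ★★ `sum_normSq_lineFun_sub_combFaceFun_le` — `Σ_c ‖V_k⁻¹•(gL·A_c·gR) − V_k⁻¹•(gL·(ℓ•F′_c)·gR)‖² ≤ 2·ℓ⁴V_k⁻¹·Σ_b‖R(W_b)Y(b+e) − Y(b)‖² + 2·C_G2²·2ℓ²V_k⁻¹·(Σ_b‖Y b‖² + ℓ²Σ_b‖R(W_b)Y(b+e) − Y(b)‖²)`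
  (`A_c` the straight-line block functional of ✓p669695, `F′_c` the comb-direct face functional of ✓p670095, `C_G2 = ((2d+1)ℓ)²∕2·δ`).
HONEST SCOPE.  The triangle inequality over two landed theorems; no new estimate; nothing of Bałaban's asserted.

References: T. Bałaban, CMP 95 (1984) 17–40 [Balaban1984PropagatorsI] ((1.18)–(1.21) pp.20–21); CMP 98 (1985) 17–51 [Balaban1985Averaging] ((9) p.18, (19)–(20) p.21);
CMP 102 (1985) 277–309 [Balaban1985Variational] (Prop. 7 p.299, (6) p.278).
-/

set_option autoImplicit false

noncomputable section

open scoped BigOperators Matrix.Norms.L2Operator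

namespace Summit.QuantumFields.YangMills.Theorems.Prop7CovFaceFluxLineStepPrime

open Literature.MathematicalPhysics.QuantumFieldTheory.Balaban1983to89
open Finset
open B7Prop1Explicit (U1 treeWord)
open B7Eq78Linearization (conjR)
open B10Eq27TorusAxialLog (holT unitsField toUField)
open Summit.QuantumFields.YangMills.Theorems.Prop7CovFaceFluxLineStep (sum_normSq_lineFun_sub_faceFun_le)
open Summit.QuantumFields.YangMills.Theorems.Prop7CovFaceFluxFacePiece (sum_normSq_faceFun_sub_combFaceFun_le)
open Summit.QuantumFields.YangMills.Theorems.Prop7CovariantCoercivity (holT_mem)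

variable {P : Params} {k : ℕ} {N : ℕ} [NeZero N]

/-- `‖a − c‖² ≤ 2‖a − b‖² + 2‖b − c‖²` in any seminormed group. [folklore] -/
theorem norm_sub_sq_le_two {E : Type*} [SeminormedAddCommGroup E] (a b c : E) : ‖a - c‖ ^ 2 ≤ 2 * ‖a - b‖ ^ 2 + 2 * ‖b - c‖ ^ 2 := by
  have h : ‖a - c‖ ≤ ‖a - b‖ + ‖b - c‖ := by
    have := norm_add_le (a - b) (b - c)
    rwa [sub_add_sub_cancel] at this
  have h0 : 0 ≤ ‖a - c‖ := norm_nonneg _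
  nlinarith [h, h0, sq_nonneg (‖a - b‖ - ‖b - c‖), norm_nonneg (a - b), norm_nonneg (b - c)]

/-- ★★ **THE (E)-ROW WITH THE COMB-DIRECT FACE FUNCTIONAL** (LOCATE-HXB-SPLIT cure (b)): for an `SU(N)` background `W` with `PlaqSmall δ W`, contractive frames, corner combs and face indices
`s′ c r = r_μ + t₀ c r`:  `Σ_c ‖LINE_c − FACE′_c‖² ≤ 2·ℓ⁴V_k⁻¹·G_long(Y) + 2·(((2d+1)ℓ)²δ∕2)²·2ℓ²V_k⁻¹·(M(Y) + ℓ²G_long(Y))` — ✓p669695 (LINE − FACE) + ✓p670095 (FACE − FACE′) + the triangle inequality.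
[cite: Balaban1984PropagatorsI, (1.18)-(1.21) pp.20-21; Balaban1985Averaging, (9) p.18, (19)-(20) p.21; Balaban1985Variational, Prop. 7 p.299] -/
theorem sum_normSq_lineFun_sub_combFaceFun_le (h : P.sitesPerDir 0 = P.L ^ k * P.sitesPerDir k)
    (W : GaugeField P 0 (Matrix.specialUnitaryGroup (Fin N) ℂ)) {δ : ℝ} (hδ : 0 ≤ δ) (hW : PlaqSmall δ W)
    (gL gR : PBond P k → Matrix (Fin N) (Fin N) ℂ) (hgL : ∀ c, ‖gL c‖ ≤ 1) (hgR : ∀ c, ‖gR c‖ ≤ 1)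
    (t₀ : PBond P k → (Fin P.d → Fin (P.L ^ k)) → ℕ) (s' : PBond P k → (Fin P.d → Fin (P.L ^ k)) → Fin (P.L ^ k))
    (hs' : ∀ c r, ((s' c r : ℕ)) = (r c.dir : ℕ) + t₀ c r)
    (Y : PBond P 0 → Matrix (Fin N) (Fin N) ℂ) :
    ∑ c : PBond P k, ‖(((P.L : ℝ) ^ k) ^ P.d)⁻¹ • (gL c * (∑ r : Fin P.d → Fin (P.L ^ k), ∑ s ∈ range (P.L ^ k),
            conjR (holT (unitsField (toUField W)) (Site.fibreSite 0 k c.src fun _ => ⟨0, pow_pos P.L_pos k⟩) (treeWord fun ν => ((r ν : ℕ) : ℤ))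
                * holT (unitsField (toUField W)) (Site.fibreSite 0 k c.src r) (List.replicate s (c.dir, true)))
              (Y ⟨(fun z : Site P 0 => z.shift c.dir)^[s] (Site.fibreSite 0 k c.src r), c.dir⟩)) * gR c)
        - (((P.L : ℝ) ^ k) ^ P.d)⁻¹ • (gL c * (((P.L : ℝ) ^ k) • ∑ r : Fin P.d → Fin (P.L ^ k),
            conjR (holT (unitsField (toUField W)) (Site.fibreSite 0 k c.src fun _ => ⟨0, pow_pos P.L_pos k⟩) (treeWord fun ν => ((Function.update r c.dir (s' c r) ν : ℕ) : ℤ)))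
              (Y ⟨(fun z : Site P 0 => z.shift c.dir)^[t₀ c r] (Site.fibreSite 0 k c.src r), c.dir⟩)) * gR c)‖ ^ 2
      ≤ 2 * (((P.L : ℝ) ^ k) ^ 4 * (((P.L : ℝ) ^ k) ^ P.d)⁻¹ *
              ∑ b : PBond P 0, ‖conjR (unitsField (toUField W) b) (Y ⟨b.src.shift b.dir, b.dir⟩) - Y b‖ ^ 2)
        + 2 * ((((((2 * P.d + 1) * P.L ^ k : ℕ) : ℝ) ^ 2 / 2) * δ) ^ 2 * 2 * ((P.L : ℝ) ^ k) ^ 2 * (((P.L : ℝ) ^ k) ^ P.d)⁻¹ *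
              (∑ b : PBond P 0, ‖Y b‖ ^ 2 + ((P.L : ℝ) ^ k) ^ 2 * ∑ b : PBond P 0, ‖conjR (unitsField (toUField W) b) (Y ⟨b.src.shift b.dir, b.dir⟩) - Y b‖ ^ 2)) := by
  -- the background in units is `U1`-valued, hence so are the corner combs
  letI : CStarAlgebra (Matrix (Fin N) (Fin N) ℂ) := B10Eq29TubeLine.cstarAlgebraMatrix N
  have hV : ∀ b, unitsField (toUField W) b ∈ U1 (Matrix (Fin N) (Fin N) ℂ) :=
    fun b => B7Prop2Explicit.unitaryUnits_le_U1 (B10Eq27TorusAxialLog.unitsField_mem_unitaryUnits (toUField W) b)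
  have hw : ∀ (c : PBond P k) (r : Fin P.d → Fin (P.L ^ k)),
      holT (unitsField (toUField W)) (Site.fibreSite 0 k c.src fun _ => ⟨0, pow_pos P.L_pos k⟩) (treeWord fun ν => ((r ν : ℕ) : ℤ)) ∈ U1 (Matrix (Fin N) (Fin N) ℂ) :=
    fun c r => holT_mem hV _ _
  have ht₀ : ∀ c r, t₀ c r < P.L ^ k := fun c r => by
    have := (s' c r).isLt
    rw [hs' c r] at this
    omega
  have hE := sum_normSq_lineFun_sub_faceFun_le h hV gL gR hgL hgR
    (fun c r => holT (unitsField (toUField W)) (Site.fibreSite 0 k c.src fun _ => ⟨0, pow_pos P.L_pos k⟩) (treeWord fun ν => ((r ν : ℕ) : ℤ))) hw t₀ ht₀ Y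
  have hG := sum_normSq_faceFun_sub_combFaceFun_le h W hδ hW gL gR hgL hgR t₀ s' hs' Y
  -- triangle inequality per coarse bond, summed
  refine le_trans (Finset.sum_le_sum fun c _ => norm_sub_sq_le_two _
    ((((P.L : ℝ) ^ k) ^ P.d)⁻¹ • (gL c * (((P.L : ℝ) ^ k) • ∑ r : Fin P.d → Fin (P.L ^ k),
            conjR (holT (unitsField (toUField W)) (Site.fibreSite 0 k c.src fun _ => ⟨0, pow_pos P.L_pos k⟩) (treeWord fun ν => ((r ν : ℕ) : ℤ))
                * holT (unitsField (toUField W)) (Site.fibreSite 0 k c.src r) (List.replicate (t₀ c r) (c.dir, true)))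
              (Y ⟨(fun z : Site P 0 => z.shift c.dir)^[t₀ c r] (Site.fibreSite 0 k c.src r), c.dir⟩)) * gR c)) _) ?_
  rw [Finset.sum_add_distrib, ← Finset.mul_sum, ← Finset.mul_sum]
  exact add_le_add (mul_le_mul_of_nonneg_left hE (by norm_num)) (mul_le_mul_of_nonneg_left hG (by norm_num))

end Summit.QuantumFields.YangMills.Theorems.Prop7CovFaceFluxLineStepPrime

end
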